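import Summits.Ventures.HSemireg.EmbeddedFirstOrderDeformationsCechTrivialBundle

/-!
# Venture HSemireg — `𝒪_{ℙ¹}(m)` for EVERY `m ≥ 0`: the zero section lifts along the shear, NOT uniquely
# (the general non-negative rung; `…CechTrivialBundle` is the case `m = 0`)

HONEST FRAMING.  Lean side of the computation cell `pub-hsemireg` (track «S4-PUSH» (ii), seat s4-prove-3 g6, second
route for (S5)); log `s4push/prove-3/ATTEMPT-10.md` §5l.  Same charts, overlap and twist `θ = s⁻¹∂/∂p` as the rest
of the ladder, gluing `t = s⁻¹`, `q = s^{−m}p` (total space of `𝒪_{ℙ¹}(m)`, `m ≥ 0` a parameter; normal bundle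
`𝒪(m)`, `h⁰ = m + 1`, `h¹ = 0`): the zero section LIFTS (`φ₀ = 0`, `φ₁ = (q ↦ t^{m+1})`) and NOT uniquely (the
pair `(s^m, 1)` is a non-zero compatible family, so `K ≠ K + (s^m, 1)`).  Plain commutative algebra; no Mathlib
scheme, sheaf, abelian variety or semiregularity map; nothing here says that HC, HC_CM or HC_AV holds; no object is
certified; no Literature fact is declared.

WHAT (namespace `Summit.Ventures.HSemireg.EmbeddedDeformation.DoubledLine`; parameter `m : ℕ`): `psiP₀/psiPHom/psiP`
(`s ↦ s⁻¹`, `p ↦ s^{−m}p`, an involution), `resMP`, `preservesLifts_resMP`, `thickenedAtlas_plus`; `tPowNormal`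
(`= s^{m+1}·unitNormal`), **`exists_isAtlasLift_plus`**; `plusFamily = (s^m·1, 1)`, `plusFamily_compatible`,
**`exists_ne_isAtlasLift_plus`** (two different lifts).  With `…CechMinusNCurve` (`n ≥ 2`: no lift),
`…CechMinusOneCurve`/`…Rigid` (`n = 1`: unique lift): over ALL integers, the zero section of `𝒪_{ℙ¹}(−n)` lifts along
`s⁻¹∂/∂p` iff `n ≤ 1`, uniquely iff `n = 1` — `h¹(𝒪(−n)) = 0 ⟺ n ≤ 1`, `h⁰(𝒪(−n)) = 0 ⟺ n ≥ 1`.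

References: R. Hartshorne, *Deformation Theory*, GTM 257 (2010), §6 Thm. 6.2 (b) [corpus:
book:springernd-deformation-theory p0054].
-/

namespace Summit.Ventures.HSemireg

namespace EmbeddedDeformation

namespace DoubledLine

open DualNumber TrivSqZeroExt MvPolynomial

universe u

variable (k : Type u) [CommRing k] (m : ℕ)

/-! ### §2 The coordinate change `s ↦ s⁻¹, p ↦ s^{-m}p` of `𝒪_{ℙ¹}(m)` and its atlas -/

/-- `k[s,p] → k[s,s⁻¹,p]`, `s ↦ s⁻¹`, `p ↦ s^{-m}p` (second chart of `𝒪_{ℙ¹}(m)`: `t = s⁻¹`, `q = t^m p`). -/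
noncomputable def psiP₀ : A k →+* L k :=
  (MvPolynomial.aeval ![IsLocalization.Away.invSelf (X 0 : A k),
    IsLocalization.Away.invSelf (X 0 : A k) ^ m * algebraMap (A k) (L k) (X 1)]).toRingHom

/-- `psiP₀ s = s⁻¹`. [folklore] -/
theorem psiP₀_X_zero : psiP₀ k m (X 0) = IsLocalization.Away.invSelf (X 0 : A k) := by
  rw [psiP₀, AlgHom.toRingHom_eq_coe, AlgHom.coe_toRingHom, MvPolynomial.aeval_X]; rfl

/-- `psiP₀ p = (s⁻¹)^m·p`. [folklore] -/
theorem psiP₀_X_one :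
    psiP₀ k m (X 1) = IsLocalization.Away.invSelf (X 0 : A k) ^ m * algebraMap (A k) (L k) (X 1) := by
  rw [psiP₀, AlgHom.toRingHom_eq_coe, AlgHom.coe_toRingHom, MvPolynomial.aeval_X]; rfl

/-- `psiP₀` on constants. [folklore] -/
theorem psiP₀_C (c : k) : psiP₀ k m (C c) = algebraMap (A k) (L k) (C c) := by
  rw [psiP₀, AlgHom.toRingHom_eq_coe, AlgHom.coe_toRingHom, MvPolynomial.algHom_C, ← MvPolynomial.algebraMap_eq]
  exact IsScalarTower.algebraMap_apply k (A k) (L k) c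

/-- `psiP₀ s` is a unit. [folklore] -/
theorem isUnit_psiP₀_X_zero : IsUnit (psiP₀ k m (X 0)) := by
  rw [psiP₀_X_zero]
  exact IsUnit.of_mul_eq_one_right _ (IsLocalization.Away.mul_invSelf (S := L k) (X 0 : A k))

/-- The coordinate change extended to `L`. [folklore] -/
noncomputable def psiPHom : L k →+* L k :=
  IsLocalization.Away.lift (X 0 : A k) (isUnit_psiP₀_X_zero k m)

/-- `psiPHom (a/1) = psiP₀ a`. [folklore] -/
theorem psiPHom_algebraMap (a : A k) : psiPHom k m (algebraMap (A k) (L k) a) = psiP₀ k m a :=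
  IsLocalization.Away.lift_eq (X 0 : A k) (isUnit_psiP₀_X_zero k m) a

/-- `psiPHom (s⁻¹) = s`. [folklore] -/
theorem psiPHom_invSelf : psiPHom k m (IsLocalization.Away.invSelf (X 0 : A k)) = algebraMap (A k) (L k) (X 0) := by
  have h1 : psiPHom k m (algebraMap (A k) (L k) (X 0)) * psiPHom k m (IsLocalization.Away.invSelf (X 0 : A k)) = 1 := by
    rw [← map_mul, IsLocalization.Away.mul_invSelf, map_one]
  rw [psiPHom_algebraMap, psiP₀_X_zero] at h1
  have h2 : IsLocalization.Away.invSelf (X 0 : A k) * algebraMap (A k) (L k) (X 0) = 1 := by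
    rw [mul_comm, IsLocalization.Away.mul_invSelf]
  calc psiPHom k m (IsLocalization.Away.invSelf (X 0 : A k))
      = (IsLocalization.Away.invSelf (X 0 : A k) * algebraMap (A k) (L k) (X 0)) *
          psiPHom k m (IsLocalization.Away.invSelf (X 0 : A k)) := by rw [h2, one_mul]
    _ = algebraMap (A k) (L k) (X 0) *
          (IsLocalization.Away.invSelf (X 0 : A k) * psiPHom k m (IsLocalization.Away.invSelf (X 0 : A k))) := by ring
    _ = algebraMap (A k) (L k) (X 0) := by rw [h1, mul_one]

/-- `psiPHom` is an involution. [folklore] -/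
theorem psiPHom_comp_psiPHom : (psiPHom k m).comp (psiPHom k m) = RingHom.id (L k) := by
  refine IsLocalization.ringHom_ext (Submonoid.powers (X 0 : A k)) ?_
  refine MvPolynomial.ringHom_ext (fun c ↦ ?_) (fun i ↦ ?_)
  · simp only [RingHom.comp_apply, RingHom.id_apply, ← MvPolynomial.algebraMap_eq]
    rw [MvPolynomial.algebraMap_eq, psiPHom_algebraMap, psiP₀_C, psiPHom_algebraMap, psiP₀_C]
  · simp only [RingHom.comp_apply, RingHom.id_apply]
    fin_cases i
    · simp only [Fin.zero_eta, psiPHom_algebraMap, psiP₀_X_zero, psiPHom_invSelf]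
    · simp only [Fin.mk_one, psiPHom_algebraMap, psiP₀_X_one, map_mul, map_pow, psiPHom_invSelf]
      rw [← mul_assoc, ← mul_pow, IsLocalization.Away.mul_invSelf, one_pow, one_mul]

/-- The coordinate change as a ring automorphism (an involution). [folklore] -/
noncomputable def psiP : L k ≃+* L k :=
  RingEquiv.ofRingHom (psiPHom k m) (psiPHom k m) (psiPHom_comp_psiPHom k m) (psiPHom_comp_psiPHom k m)

/-- The chart maps of `𝒪_{ℙ¹}(m)` into the overlap. -/
noncomputable def resMP : Fin 2 → (A k →+* L k) :=
  ![algebraMap (A k) (L k), (psiP k m : L k →+* L k).comp (algebraMap (A k) (L k))]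

/-- `resMP 1 = psiP ∘` localisation. -/
theorem resMP_one : resMP k m 1 = (psiP k m : L k →+* L k).comp (algebraMap (A k) (L k)) := rfl

/-- `resMP 1 a = psiPHom (a/1)`. -/
theorem resMP_one_apply (a : A k) : resMP k m 1 a = psiPHom k m (algebraMap (A k) (L k) a) := rfl

/-- `resMP 1 (p) = s^{-m}p`. [folklore] -/
theorem resMP_one_X_one :
    resMP k m 1 (X 1) = IsLocalization.Away.invSelf (X 0 : A k) ^ m * algebraMap (A k) (L k) (X 1) := by
  rw [resMP_one_apply, psiPHom_algebraMap, psiP₀_X_one]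

/-- `(p)·L` is `psiP`-stable (`s^{-m}` is a unit). [folklore] -/
theorem map_psiP_idealZ₂ (α β : Fin 2) : (idealZ₂ k α β).map (psiP k m : L k →+* L k) = idealZ₂ k α β := by
  change ((Ideal.span {(X 1 : A k)}).map _).map _ = (Ideal.span {(X 1 : A k)}).map _
  rw [Ideal.map_map, Ideal.map_span, Ideal.map_span, Set.image_singleton, Set.image_singleton, RingHom.comp_apply]
  change Ideal.span {psiPHom k m _} = _
  rw [psiPHom_algebraMap, psiP₀_X_one]
  exact Ideal.span_singleton_mul_left_unit
    ((IsUnit.of_mul_eq_one_right _ (IsLocalization.Away.mul_invSelf (S := L k) (X 0 : A k))).pow m) _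

/-- Both chart maps carry flat lifts (as in `…CechMinusTwoCurve` / `…CechMinusOneCurve`). [folklore] -/
theorem preservesLifts_resMP : ∀ α β : Fin 2,
    PreservesLifts (fstRingHom (A k)) (ε : (A k)[ε]) (fstRingHom (L k)) (ε : (L k)[ε]) (mapRingHom (resMP k m α))
      (idealZ k α) (idealZ₂ k α β) := by
  intro α β
  fin_cases α
  · exact preservesLifts_mapRingHom_of_isLocalization (Submonoid.powers (X 0 : A k)) _
  · show PreservesLifts _ _ _ _ (mapRingHom (resMP k m 1)) (idealZ k 1) (idealZ₂ k 1 β)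
    rw [resMP_one, mapRingHom_comp', ← coe_mapRingEquiv]
    intro K hK
    have h1 := preservesLifts_mapRingHom_of_isLocalization (S := L k) (Submonoid.powers (X 0 : A k)) (idealZ k 1) hK
    have h2 := h1.map_ringEquivPair (τ := fstRingHom (L k)) (e' := (ε : (L k)[ε])) (mapRingEquiv (psiP k m)) (psiP k m)
      (fun z ↦ by
        show (mapRingHom (psiP k m : L k →+* L k) z).fst = psiP k m z.fst
        exact fst_mapRingHom _ z)
      (by
        show mapRingHom (psiP k m : L k →+* L k) ε = ε
        exact mapRingHom_eps _)
    rw [Ideal.map_map, Ideal.map_map] at h2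
    have h3 : (idealZ k 1).map ((psiP k m : L k →+* L k).comp (algebraMap (A k) (L k))) = idealZ₂ k 1 β := by
      rw [← Ideal.map_map]
      exact map_psiP_idealZ₂ k m 1 β
    rw [h3] at h2
    exact h2

/-- **`𝒪_{ℙ¹}(m)` with the same shear IS a thickened atlas.** [folklore] -/
theorem thickenedAtlas_plus :
    ThickenedAtlas (fun _ : Fin 2 ↦ fstRingHom (A k)) (fun _ ↦ (ε : (A k)[ε])) (fun _ _ ↦ fstRingHom (L k))
      (fun _ _ ↦ (ε : (L k)[ε])) (fun α _ ↦ mapRingHom (resMP k m α)) (fun α _ ↦ resMP k m α)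
      (fun α β ↦ (twist (thetaFamily k α β) : (L k)[ε] →+* (L k)[ε]).comp (mapRingHom (resMP k m β)))
      (fun _ β ↦ resMP k m β) (idealZ k) (idealZ₂ k) :=
  thickenedAtlas_twisted (fun α _ ↦ resMP k m α) (fun _ β ↦ resMP k m β) (idealZ k) (idealZ₂ k) (thetaFamily k)
    (preservesLifts_resMP k m) (fun α β ↦ preservesLifts_resMP k m β α)

/-! ### §3 The zero section of `𝒪_{ℙ¹}(m)` lifts -/

/-- `(s/1)^j · (s⁻¹)^j = 1`. [folklore] -/
theorem algebraMap_pow_mul_invSelf_pow (j : ℕ) :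
    algebraMap (A k) (L k) (X 0) ^ j * IsLocalization.Away.invSelf (S := L k) (X 0 : A k) ^ j = 1 := by
  rw [← mul_pow, IsLocalization.Away.mul_invSelf, one_pow]

/-- `⟨s^{−m}p⟩ = (s⁻¹)^m • ⟨p⟩` in `(p)·L`. [folklore] -/
theorem resMP_one_X_one_smul {γ δ : Fin 2} (hmem : algebraMap (A k) (L k) (X 1) ∈ idealZ₂ k γ δ)
    (hmem₁ : resMP k m 1 (X 1) ∈ idealZ₂ k γ δ) :
    (⟨resMP k m 1 (X 1), hmem₁⟩ : idealZ₂ k γ δ) =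
      IsLocalization.Away.invSelf (S := L k) (X 0 : A k) ^ m •
        (⟨algebraMap (A k) (L k) (X 1), hmem⟩ : idealZ₂ k γ δ) :=
  Subtype.ext (by
    show resMP k m 1 (X 1) = IsLocalization.Away.invSelf (S := L k) (X 0 : A k) ^ m * algebraMap (A k) (L k) (X 1)
    rw [resMP_one_X_one])

/-- Cancelling `(s⁻¹)^m`: if `(s⁻¹)^m • v = w` then `v = s^m • w`. [folklore] -/
theorem eq_smul_of_invSelf_pow_smul {N : Type*} [AddCommGroup N] [Module (L k) N] {v w : N}
    (h : IsLocalization.Away.invSelf (S := L k) (X 0 : A k) ^ m • v = w) :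
    v = algebraMap (A k) (L k) (X 0) ^ m • w := by
  rw [← h, ← mul_smul, algebraMap_pow_mul_invSelf_pow, one_smul]

/-- The normal field `q ↦ t^{m+1}` of chart 1 in `k[s,p]`-coordinates: `s^{m+1} · unitNormal`. -/
noncomputable def tPowNormal : idealZ k 1 →ₗ[A k] A k ⧸ idealZ k 1 := (X 0 ^ (m + 1) : A k) • unitNormal k 1

/-- `tPowNormal (p) = s^{m+1} mod p`. [folklore] -/
theorem tPowNormal_apply_X_one (h : (X 1 : A k) ∈ idealZ k 1) :
    tPowNormal k m ⟨X 1, h⟩ = Ideal.Quotient.mk _ (X 0 ^ (m + 1)) := by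
  rw [tPowNormal, LinearMap.smul_apply, unitNormal_apply_X_one]
  change Ideal.Quotient.mk (idealZ k 1) (X 0 ^ (m + 1) * 1) = _
  rw [mul_one]

/-- The restriction of `tPowNormal` along the second chart map at the generator `p/1` is `s⁻¹`
(its value at `s^{−m}p` is `(s⁻¹)^{m+1}`). [folklore] -/
theorem res_tPowNormal_apply {γ δ : Fin 2} {ρ : (A k)[ε] →+* (L k)[ε]}
    (hρ : IsThickeningHom (fstRingHom (A k)) (ε : (A k)[ε]) (fstRingHom (L k)) (ε : (L k)[ε]) ρ (resMP k m 1))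
    (hP : PreservesLifts (fstRingHom (A k)) (ε : (A k)[ε]) (fstRingHom (L k)) (ε : (L k)[ε]) ρ (idealZ k 1)
      (idealZ₂ k γ δ))
    {K₀ : Ideal (A k)[ε]} (h₀ : IsLift (fstRingHom (A k)) (ε : (A k)[ε]) (idealZ k 1) K₀)
    (hmem : algebraMap (A k) (L k) (X 1) ∈ idealZ₂ k γ δ) :
    resNormal (isFirstOrderThickening_dualNumber (A k)) (isFirstOrderThickening_dualNumber (L k)) hP h₀
        (tPowNormal k m) ⟨algebraMap (A k) (L k) (X 1), hmem⟩ =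
      Ideal.Quotient.mk (idealZ₂ k γ δ) (IsLocalization.Away.invSelf (X 0 : A k)) := by
  have hX1 : (X 1 : A k) ∈ idealZ k 1 := Ideal.subset_span rfl
  have hmem₁ : resMP k m 1 (X 1) ∈ idealZ₂ k γ δ := by
    rw [resMP_one_X_one]
    exact Ideal.mul_mem_left _ _ hmem
  have e1 := resNormal_apply (hT := isFirstOrderThickening_dualNumber (A k))
    (hT' := isFirstOrderThickening_dualNumber (L k)) hρ hP h₀ (tPowNormal k m) ⟨X 1, hX1⟩ (X 0 ^ (m + 1))
    (tPowNormal_apply_X_one k m hX1).symm hmem₁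
  rw [resMP_one_X_one_smul k m hmem hmem₁, map_smul, map_pow, resMP_one_apply, psiPHom_algebraMap,
    psiP₀_X_zero] at e1
  have hsm : ∀ c a : L k, c • Ideal.Quotient.mk (idealZ₂ k γ δ) a = Ideal.Quotient.mk (idealZ₂ k γ δ) (c * a) :=
    fun _ _ ↦ rfl
  rw [eq_smul_of_invSelf_pow_smul k m e1, hsm, pow_succ, ← mul_assoc, algebraMap_pow_mul_invSelf_pow, one_mul]

/-- **THE ZERO SECTION OF `𝒪_{ℙ¹}(m)` LIFTS** (`m ≥ 0`) to the deformation glued by `t = s⁻¹`,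
`q = t^m p + εt` (the twist `s⁻¹∂/∂p`): coboundary `φ₀ = 0`, `φ₁ = (q ↦ t^{m+1})`, since
`φ₁|(p) = s^m·φ₁|(s^{−m}p) = s^m·s^{−m−1} = s⁻¹ = θ̄(p)`. [cite: Hartshorne2010, §6 Thm. 6.2 (b)] -/
theorem exists_isAtlasLift_plus :
    ∃ K : Fin 2 → Ideal (A k)[ε],
      IsAtlasLift (fun _ : Fin 2 ↦ fstRingHom (A k)) (fun _ ↦ (ε : (A k)[ε])) (fun α _ ↦ mapRingHom (resMP k m α))
        (fun α β ↦ (twist (thetaFamily k α β) : (L k)[ε] →+* (L k)[ε]).comp (mapRingHom (resMP k m β)))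
        (idealZ k) K := by
  have 𝔄 := thickenedAtlas_twisted (fun α _ ↦ resMP k m α) (fun _ β ↦ resMP k m β) (idealZ k) (idealZ₂ k)
    (thetaFamily k) (preservesLifts_resMP k m) (fun α β ↦ preservesLifts_resMP k m β α)
  have hsec := isLift_map_chartSection 𝔄 (fun _ ↦ algebraMap (A k) (A k)[ε]) fun _ ↦ fstRingHom_algebraMap
  refine (exists_isAtlasLift_twisted_iff (fun α _ ↦ resMP k m α) (fun _ β ↦ resMP k m β) (idealZ k) (idealZ₂ k)
    (thetaFamily k) (preservesLifts_resMP k m) (fun α β ↦ preservesLifts_resMP k m β α)).2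
    ⟨![0, tPowNormal k m], fun α β ↦ ?_⟩
  have hmem : algebraMap (A k) (L k) (X 1) ∈ idealZ₂ k α β := Ideal.mem_map_of_mem _ (Ideal.subset_span rfl)
  refine ext_of_span_X_one k hmem ?_
  rw [derivToNormal_apply, LinearMap.sub_apply]
  fin_cases α <;> fin_cases β
  · show Ideal.Quotient.mk _ (thetaFamily k 0 0 _) = resR 𝔄 hsec 0 0 0 _ - resL 𝔄 hsec 0 0 0 _
    rw [resR, resL, resNormal_zero (𝔄.homr 0 0) (𝔄.liftsr 0 0) (hsec 0), resNormal_zero (𝔄.homl 0 0) (𝔄.liftsl 0 0)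
      (hsec 0), thetaFamily]
    simp
  · show Ideal.Quotient.mk _ (thetaFamily k 0 1 _) = resR 𝔄 hsec 0 1 (tPowNormal k m) _ - resL 𝔄 hsec 0 1 0 _
    rw [resR, resL, resNormal_zero (𝔄.homl 0 1) (𝔄.liftsl 0 1) (hsec 0), LinearMap.zero_apply, sub_zero,
      res_tPowNormal_apply k m (𝔄.homr 0 1) (𝔄.liftsr 0 1) (hsec 1) hmem, thetaFamily_zero_one,
      theta_algebraMap_X_one]
  · show Ideal.Quotient.mk _ (thetaFamily k 1 0 _) = resR 𝔄 hsec 1 0 0 _ - resL 𝔄 hsec 1 0 (tPowNormal k m) _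
    rw [resR, resL, resNormal_zero (𝔄.homr 1 0) (𝔄.liftsr 1 0) (hsec 0), LinearMap.zero_apply, zero_sub,
      res_tPowNormal_apply k m (𝔄.homl 1 0) (𝔄.liftsl 1 0) (hsec 1) hmem, ← map_neg, thetaFamily]
    simp [theta_algebraMap_X_one]
  · show Ideal.Quotient.mk _ (thetaFamily k 1 1 _) =
      resR 𝔄 hsec 1 1 (tPowNormal k m) _ - resL 𝔄 hsec 1 1 (tPowNormal k m) _
    rw [resR, resL, res_tPowNormal_apply k m (𝔄.homr 1 1) (𝔄.liftsr 1 1) (hsec 1) hmem,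
      res_tPowNormal_apply k m (𝔄.homl 1 1) (𝔄.liftsl 1 1) (hsec 1) hmem, sub_self, thetaFamily]
    simp

/-! ### §4 … but not uniquely: `(s^m·1, 1)` is a non-zero Čech `0`-cocycle -/

/-- The compatible family `(s^m · 1, 1)` (the global section `t^m… = s^m`-weighted constant of `𝒪(m)`). -/
noncomputable def plusFamily : ∀ α : Fin 2, idealZ k α →ₗ[A k] A k ⧸ idealZ k α :=
  ![(X 0 ^ m : A k) • unitNormal k 0, unitNormal k 1]

/-- `plusFamily 0 (p) = s^m mod p`. [folklore] -/
theorem plusFamily_zero_apply (h : (X 1 : A k) ∈ idealZ k 0) :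
    plusFamily k m 0 ⟨X 1, h⟩ = Ideal.Quotient.mk _ (X 0 ^ m) := by
  change ((X 0 ^ m : A k) • unitNormal k 0) ⟨X 1, h⟩ = _
  rw [LinearMap.smul_apply, unitNormal_apply_X_one]
  change Ideal.Quotient.mk (idealZ k 0) (X 0 ^ m * 1) = _
  rw [mul_one]

/-- `plusFamily 1 (q) = 1`. [folklore] -/
theorem plusFamily_one_apply (h : (X 1 : A k) ∈ idealZ k 1) :
    plusFamily k m 1 ⟨X 1, h⟩ = Ideal.Quotient.mk _ 1 := by
  change unitNormal k 1 ⟨X 1, h⟩ = _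
  rw [unitNormal_apply_X_one]

/-- Restricting `plusFamily α` along `resMP α` gives `s^m` at the generator, for BOTH `α`. [folklore] -/
theorem res_plusFamily_apply (α : Fin 2) {γ δ : Fin 2} {ρ : (A k)[ε] →+* (L k)[ε]}
    (hρ : IsThickeningHom (fstRingHom (A k)) (ε : (A k)[ε]) (fstRingHom (L k)) (ε : (L k)[ε]) ρ (resMP k m α))
    (hP : PreservesLifts (fstRingHom (A k)) (ε : (A k)[ε]) (fstRingHom (L k)) (ε : (L k)[ε]) ρ (idealZ k α)
      (idealZ₂ k γ δ))
    {K₀ : Ideal (A k)[ε]} (h₀ : IsLift (fstRingHom (A k)) (ε : (A k)[ε]) (idealZ k α) K₀)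
    (hmem : algebraMap (A k) (L k) (X 1) ∈ idealZ₂ k γ δ) :
    resNormal (isFirstOrderThickening_dualNumber (A k)) (isFirstOrderThickening_dualNumber (L k)) hP h₀
        (plusFamily k m α) ⟨algebraMap (A k) (L k) (X 1), hmem⟩ =
      Ideal.Quotient.mk (idealZ₂ k γ δ) (algebraMap (A k) (L k) (X 0) ^ m) := by
  have hX1 : (X 1 : A k) ∈ idealZ k α := Ideal.subset_span rfl
  have hsm : ∀ c a : L k, c • Ideal.Quotient.mk (idealZ₂ k γ δ) a = Ideal.Quotient.mk (idealZ₂ k γ δ) (c * a) :=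
    fun _ _ ↦ rfl
  obtain rfl | rfl : α = 0 ∨ α = 1 := by fin_cases α <;> simp
  · have e1 : resNormal (isFirstOrderThickening_dualNumber (A k)) (isFirstOrderThickening_dualNumber (L k)) hP h₀
        (plusFamily k m 0) ⟨algebraMap (A k) (L k) (X 1), hmem⟩ =
        Ideal.Quotient.mk (idealZ₂ k γ δ) (algebraMap (A k) (L k) (X 0 ^ m)) :=
      resNormal_apply (hT := isFirstOrderThickening_dualNumber (A k))
        (hT' := isFirstOrderThickening_dualNumber (L k)) hρ hP h₀ (plusFamily k m 0) ⟨X 1, hX1⟩ (X 0 ^ m)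
        (plusFamily_zero_apply k m hX1).symm hmem
    rw [e1, map_pow]
  · have hmem₁ : resMP k m 1 (X 1) ∈ idealZ₂ k γ δ := by
      rw [resMP_one_X_one]
      exact Ideal.mul_mem_left _ _ hmem
    have e1 := resNormal_apply (hT := isFirstOrderThickening_dualNumber (A k))
      (hT' := isFirstOrderThickening_dualNumber (L k)) hρ hP h₀ (plusFamily k m 1) ⟨X 1, hX1⟩ 1
      (plusFamily_one_apply k m hX1).symm hmem₁
    rw [resMP_one_X_one_smul k m hmem hmem₁, map_smul, map_one] at e1
    rw [eq_smul_of_invSelf_pow_smul k m e1, hsm, mul_one]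

/-- **`plusFamily` is a Čech `0`-cocycle of the `𝒪_{ℙ¹}(m)` atlas** (both restrictions are `s^m` at the generator),
for any base local lifts. [folklore] -/
theorem plusFamily_compatible {T : ∀ α : Fin 2, Ideal (A k)[ε]}
    (hT : ∀ α, IsLift (fstRingHom (A k)) (ε : (A k)[ε]) (idealZ k α) (T α)) (α β : Fin 2) :
    resL (thickenedAtlas_plus k m) hT α β (plusFamily k m α) =
      resR (thickenedAtlas_plus k m) hT α β (plusFamily k m β) := by
  have 𝔄 := thickenedAtlas_plus k m
  have hmem : algebraMap (A k) (L k) (X 1) ∈ idealZ₂ k α β := Ideal.mem_map_of_mem _ (Ideal.subset_span rfl)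
  refine ext_of_span_X_one k hmem ?_
  rw [resL, resR, res_plusFamily_apply k m α (𝔄.homl α β) (𝔄.liftsl α β) (hT α) hmem,
    res_plusFamily_apply k m β (𝔄.homr α β) (𝔄.liftsr α β) (hT β) hmem]

/-- **TWO DIFFERENT LIFTS of the zero section of `𝒪_{ℙ¹}(m)`** (`m ≥ 0`): `K` and `K + plusFamily`, told apart on
chart 1 where `plusFamily = 1 ∉ (q)`. [cite: Hartshorne2010, §6 Thm. 6.2 (b)] -/
theorem exists_ne_isAtlasLift_plus [Nontrivial k] :
    ∃ K K' : Fin 2 → Ideal (A k)[ε],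
      IsAtlasLift (fun _ : Fin 2 ↦ fstRingHom (A k)) (fun _ ↦ (ε : (A k)[ε])) (fun α _ ↦ mapRingHom (resMP k m α))
        (fun α β ↦ (twist (thetaFamily k α β) : (L k)[ε] →+* (L k)[ε]).comp (mapRingHom (resMP k m β)))
        (idealZ k) K ∧
      IsAtlasLift (fun _ : Fin 2 ↦ fstRingHom (A k)) (fun _ ↦ (ε : (A k)[ε])) (fun α _ ↦ mapRingHom (resMP k m α))
        (fun α β ↦ (twist (thetaFamily k α β) : (L k)[ε] →+* (L k)[ε]).comp (mapRingHom (resMP k m β)))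
        (idealZ k) K' ∧ K ≠ K' := by
  obtain ⟨K, hK⟩ := exists_isAtlasLift_plus k m
  have hK' := hK.translate (thickenedAtlas_plus k m) hK.isLift (plusFamily k m) (plusFamily_compatible k m hK.isLift)
  refine ⟨K, _, hK, hK', fun h ↦ ?_⟩
  have hX1 : (X 1 : A k) ∈ idealZ k 1 := Ideal.subset_span rfl
  have h1 : (hK.isLift 1).diff ((thickenedAtlas_plus k m).thick 1) (hK'.isLift 1) = plusFamily k m 1 :=
    diff_translate _ (hK.isLift 1) (plusFamily k m 1)
  have h0 : (hK.isLift 1).diff ((thickenedAtlas_plus k m).thick 1) (hK'.isLift 1) = 0 := by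
    rw [IsLift.diff_congr ((thickenedAtlas_plus k m).thick 1) (hK.isLift 1) (hK'.isLift 1) (hK.isLift 1)
      (hK.isLift 1) rfl (congr_fun h 1).symm]
    exact (hK.isLift 1).diff_self _
  have h2 := LinearMap.congr_fun (h1.symm.trans h0) ⟨X 1, hX1⟩
  rw [plusFamily_one_apply, LinearMap.zero_apply, Ideal.Quotient.eq_zero_iff_mem] at h2
  exact one_not_mem_idealZ k 1 h2

end DoubledLine

end EmbeddedDeformation

end Summit.Ventures.HSemireg
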